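import Summits.Ventures.PercRepro.MSSplitIota

/-!
# Theorem 10.1 (cover form): the assembly

proofs/P4-gen9.md §10. A split family `F = s ⊔ t` on the support `u` with a down-closed difference
family containing every singleton, no member a difference, and Marica–Schönheim excess one has two
members covering `u` (`cover_of_split_excess_one`). Assuming no cover, the two indicators of (★)
select the case: (η) both `A₅ ∈ T` and `A₃ ∈ S` (`false_of_mem_traces_both`), (θ) neither
(`false_of_notMem_traces_both`), (ι) `A₅ ∈ T`, `A₃ ∉ S` (`false_of_mem_notMem_traces`, from the
three sub-cases of `MSSplitIota.lean`), and its mirror image by `CoverHyp.symm`.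
-/

namespace PercRepro.MSTight

open Finset
open scoped FinsetFamily

variable {α : Type*} [DecidableEq α]

section CaseIota

variable {u : Finset α} {F s t : Finset (Finset α)}

/-- **Case (ι)**: `A₅ ∈ T` and `A₃ ∉ S` are impossible without a cover. -/
theorem false_of_mem_notMem_traces (h : CoverHyp u F s t) (hnc : ∀ a ∈ F, ∀ b ∈ F, a ∪ b ≠ u)
    (hT : classA5 u s t ∈ s.image (fun a => a ∩ (classA5 u s t ∪ classA6 u s t)))
    (hS : classA3 u s t ∉ t.image (fun b => b ∩ (classA3 u s t ∪ classA4 u s t))) : False := by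
  obtain ⟨X, hX, hXtr⟩ := Finset.mem_image.1 hT
  have hc : (rest u F s t).card ≤ 1 := by
    have hst := star h
    rw [if_pos hT, if_neg hS] at hst
    omega
  by_cases h2 : ∃ r, r ∈ classA2 u s t
  · obtain ⟨a₂, ha₂⟩ := h2
    exact false_of_iota_classA2 h hnc hX hXtr hc ha₂
  by_cases h1 : ∃ r, r ∈ classA1 u s t
  · obtain ⟨a₁, ha₁⟩ := h1
    exact false_of_iota_classA1 h hnc hX hXtr hc ha₁
  push Not at h1 h2
  exact false_of_iota_empty h hnc hX hXtr hc hS h1 h2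

end CaseIota

/-- **THEOREM 10.1 (cover form).** A split family on `u` with a down-closed difference family
containing every singleton of `u`, no member a difference, and Marica–Schönheim excess one has two
members covering `u`. -/
theorem cover_of_split_excess_one {u : Finset α} {F s t : Finset (Finset α)}
    (h : CoverHyp u F s t) : ∃ a ∈ F, ∃ b ∈ F, a ∪ b = u := by
  by_contra hnc
  push Not at hnc
  by_cases hT : classA5 u s t ∈ s.image (fun a => a ∩ (classA5 u s t ∪ classA6 u s t)) <;>
    by_cases hS : classA3 u s t ∈ t.image (fun b => b ∩ (classA3 u s t ∪ classA4 u s t))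
  · exact false_of_mem_traces_both h hnc hT hS
  · exact false_of_mem_notMem_traces h hnc hT hS
  · refine false_of_mem_notMem_traces h.symm hnc ?_ ?_
    · rw [classA5_symm, classA6_symm]; exact hS
    · rw [classA3_symm, classA4_symm]; exact hT
  · exact false_of_notMem_traces_both h hnc hT hS

end PercRepro.MSTight
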